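import Summits.Ventures.YMGap.RobustBall.SummableUniqueness
import Summits.Ventures.YMGap.RobustBall.PerturbedCollar
import HarnessLib

/-!
# Venture YMGap, track ROBUST-BALL (tier 2) — the SUMMABLE (infinite-range) member's finite-volume energy is
# Lipschitz in every link through the summable cross coefficient; tails; the kernel average as a tilt

HONEST FRAMING. WHAT THIS IS: a venture file (cell `pub-ymgap`, track Y2 ROBUST-BALL, seat ds-3),
strong-coupling LATTICE bookkeeping for the TIER-2 member `N β S_W + W` of rb-p1's weighted ball
(`perturbedYMS ρ β W`, `SummableSpecification.lean`: a link potential with a summable majorant through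
every link — infinitely many active terms through a link are allowed). Part 1 of the tier-2 twin of the
seat's `PerturbedCollar` / `PerturbedSmoothing` (tier 1, finite range):
(1) `abs_tsum_volume_sub_le_of_eq_off` — the volume series `∑'_{X ∩ Λ ≠ ∅} W_X` is Lipschitz in every link
    `y` with modulus `∑_{e ∈ Λ} ∑'_{X ∋ e, y} lip X y` (termwise, through the summable cross coefficient);
(2) `abs_tsum_volume_sub_le_tail` — configurations agreeing on the links of a finite family `S` of sets
    change the series by at most twice the TAIL of the volume majorant off `S` (quasilocality);
(3) `specAvg_perturbedYMS_eq_tilted` — the tier-2 kernel average `γ^W_Λ F` as a tilted product-Haar integral;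
(4) `abs_perturbedEnergyS_sub_le_of_eq_off` — for `SU(N)` the tier-2 energy `-b S_Λ - ∑'_{X ∩ Λ ≠ ∅} W_X`
    is Lipschitz in the link `y` with modulus
    `|b| · 2(d−1)√N · 𝟙[y ∈ links of the plaquettes touching Λ] + ∑_{e ∈ Λ} ∑'_{X ∋ e, y} lip X y`.
Part 2 (`SummableSmoothing.lean`): quasilocality and sitewise Lipschitz bounds of `γ^W_Λ F`.
WHAT IT IS NOT: no door, no row, no number of the cell; nothing about the continuum or the Clay problem.

References: H.-O. Georgii, Gibbs Measures and Phase Transitions (2011), Def. 2.9, (2.11), (2.15);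
H. Föllmer, LNM 1362 (1988) Ch. I (2.4), Remark (2.17); S. Friedli, Y. Velenik (2017) §6.10.1, Lemma 6.28.
-/

noncomputable section

open MeasureTheory ProbabilityTheory Function Finset Filter Topology
open scoped NNReal
open Literature.Probability.LatticeModels
open Literature.Probability.LatticeModels.DobrushinMetric
open Literature.MathematicalPhysics.QuantumLattice
open Literature.MathematicalPhysics.QuantumFieldTheory hiding ZdEdge
open Literature.MathematicalPhysics.QuantumFieldTheory.Balaban1983to89
open Literature.MathematicalPhysics.QuantumFieldTheory.Balaban1983to89.StrongCouplingTorusWindow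
open Summit.Ventures.YMGap.ZdSmoothing

namespace Summit.Ventures.YMGap.RobustBall

variable {d N : ℕ}

/-! ### The volume series: Lipschitz in every link through the cross coefficient; tails -/

section Series

variable {G : Type*} [Group G] {W : Potential (ZdEdge d) G} {B : Finset (ZdEdge d) → ℝ}

/-- **The volume series is Lipschitz in every link through the summable cross coefficient**: with
Lipschitz witnesses `lip X` of the terms, if `U = V` off the link `y` then
`|∑'_{X ∩ Λ ≠ ∅} W_X(U) − ∑'_{X ∩ Λ ≠ ∅} W_X(V)| ≤ (∑_{e ∈ Λ} ∑'_{X ∋ e, y} lip X y) · r(U_y, V_y)`: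
only sets through `y` contribute, each by `≤ lip X y · r`, and a set meeting `Λ` is counted at some
`e ∈ X ∩ Λ` (all terms nonnegative). -/
theorem abs_tsum_volume_sub_le_of_eq_off (h : IsLinkSummable W B)
    (hWdep : ∀ X, DependsOn (W X) (↑X : Set (ZdEdge d))) {r : G → G → ℝ} (hr0 : ∀ a b, 0 ≤ r a b)
    {lip : Finset (ZdEdge d) → ZdEdge d → ℝ} (hlip : ∀ X, IsLipBound r (W X) (lip X))
    (Λ : Finset (ZdEdge d)) {y : ZdEdge d}
    (hlips : ∀ e ∈ Λ, Summable fun X : Finset (ZdEdge d) => (if e ∈ X ∧ y ∈ X then lip X y else 0))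
    {U V : LGConfig d G} (hUV : ∀ z, z ≠ y → U z = V z) :
    |(∑' X : Finset (ZdEdge d), (if (X ∩ Λ).Nonempty then W X U else 0)) -
        ∑' X : Finset (ZdEdge d), (if (X ∩ Λ).Nonempty then W X V else 0)| ≤
      (∑ e ∈ Λ, ∑' X : Finset (ZdEdge d), (if e ∈ X ∧ y ∈ X then lip X y else 0)) * r (U y) (V y) := by
  classical
  haveI : Nonempty (LGConfig d G) := ⟨fun _ => 1⟩
  have hs1 := h.summable_term Λ U
  have hs2 := h.summable_term Λ V
  have hlip0 : ∀ X z, 0 ≤ lip X z := fun X z => (hlip X).nonneg z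
  have hry : 0 ≤ r (U y) (V y) := hr0 _ _
  -- termwise bound
  have hterm : ∀ X : Finset (ZdEdge d),
      |(if (X ∩ Λ).Nonempty then W X U else 0) - (if (X ∩ Λ).Nonempty then W X V else 0)| ≤
        (∑ e ∈ Λ, (if e ∈ X ∧ y ∈ X then lip X y else 0)) * r (U y) (V y) := by
    intro X
    have hsum0 : 0 ≤ ∑ e ∈ Λ, (if e ∈ X ∧ y ∈ X then lip X y else 0) :=
      Finset.sum_nonneg fun e _ => by split_ifs <;> first | exact hlip0 X y | exact le_rfl
    by_cases hX : (X ∩ Λ).Nonempty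
    · rw [if_pos hX, if_pos hX]
      by_cases hyX : y ∈ X
      · obtain ⟨e, he⟩ := hX
        obtain ⟨heX, heΛ⟩ := Finset.mem_inter.1 he
        have hb := (hlip X).le y U V hUV
        refine hb.trans (mul_le_mul_of_nonneg_right ?_ hry)
        calc lip X y = (if e ∈ X ∧ y ∈ X then lip X y else 0) := by rw [if_pos ⟨heX, hyX⟩]
          _ ≤ ∑ e' ∈ Λ, (if e' ∈ X ∧ y ∈ X then lip X y else 0) :=
              Finset.single_le_sum (f := fun e' => if e' ∈ X ∧ y ∈ X then lip X y else 0)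
                (fun e' _ => by
                  split_ifs <;> first | exact hlip0 X y | exact le_rfl) heΛ
      · rw [hWdep X (fun z hz => hUV z (fun hzy => hyX (hzy ▸ Finset.mem_coe.1 hz))), sub_self, abs_zero]
        exact mul_nonneg hsum0 hry
    · rw [if_neg hX, if_neg hX, sub_self, abs_zero]
      exact mul_nonneg hsum0 hry
  have hsm : Summable fun X : Finset (ZdEdge d) =>
      (∑ e ∈ Λ, (if e ∈ X ∧ y ∈ X then lip X y else 0)) * r (U y) (V y) :=
    (summable_sum fun e he => hlips e he).mul_right _
  rw [← hs1.tsum_sub hs2]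
  calc |∑' X, ((if (X ∩ Λ).Nonempty then W X U else 0) - (if (X ∩ Λ).Nonempty then W X V else 0))|
      ≤ ∑' X, |(if (X ∩ Λ).Nonempty then W X U else 0) - (if (X ∩ Λ).Nonempty then W X V else 0)| := by
        have := norm_tsum_le_tsum_norm ((hs1.sub hs2).norm)
        simpa only [Real.norm_eq_abs] using this
    _ ≤ ∑' X, (∑ e ∈ Λ, (if e ∈ X ∧ y ∈ X then lip X y else 0)) * r (U y) (V y) :=
        (hs1.sub hs2).abs.tsum_le_tsum hterm hsm
    _ = (∑' X, ∑ e ∈ Λ, (if e ∈ X ∧ y ∈ X then lip X y else 0)) * r (U y) (V y) := tsum_mul_right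
    _ = (∑ e ∈ Λ, ∑' X : Finset (ZdEdge d), (if e ∈ X ∧ y ∈ X then lip X y else 0)) * r (U y) (V y) := by
        rw [Summable.tsum_finsetSum fun e he => hlips e he]

/-- **Tails: quasilocality of the volume series**: if `U = V` on a finite link set `Λ'` containing every
link of the sets of the finite family `S`, then
`|∑'_{X ∩ Λ ≠ ∅} W_X(U) − ∑'_{X ∩ Λ ≠ ∅} W_X(V)| ≤ 2 ∑'_X 𝟙[X ∉ S] ∑_{e ∈ Λ} 𝟙[e ∈ X] B_X` (the terms in
`S` cancel, the others are bounded by the volume majorant). -/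
theorem abs_tsum_volume_sub_le_tail (h : IsLinkSummable W B)
    (hWdep : ∀ X, DependsOn (W X) (↑X : Set (ZdEdge d))) (Λ : Finset (ZdEdge d))
    (S : Finset (Finset (ZdEdge d))) {Λ' : Finset (ZdEdge d)} (hΛ' : ∀ X ∈ S, ∀ z ∈ X, z ∈ Λ')
    {U V : LGConfig d G} (hUV : ∀ z ∈ Λ', U z = V z) :
    |(∑' X : Finset (ZdEdge d), (if (X ∩ Λ).Nonempty then W X U else 0)) -
        ∑' X : Finset (ZdEdge d), (if (X ∩ Λ).Nonempty then W X V else 0)| ≤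
      2 * ∑' X : Finset (ZdEdge d), (if X ∈ S then 0 else ∑ e ∈ Λ, (if e ∈ X then B X else 0)) := by
  classical
  haveI : Nonempty (LGConfig d G) := ⟨fun _ => 1⟩
  have hs1 := h.summable_term Λ U
  have hs2 := h.summable_term Λ V
  have hB0 : ∀ X, 0 ≤ B X := fun X => h.nonneg X U
  have hvol0 : ∀ X, 0 ≤ ∑ e ∈ Λ, (if e ∈ X then B X else 0) := fun X =>
    Finset.sum_nonneg fun e _ => by split_ifs <;> first | exact hB0 X | exact le_rfl
  have htail : Summable fun X : Finset (ZdEdge d) =>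
      (if X ∈ S then 0 else ∑ e ∈ Λ, (if e ∈ X then B X else 0)) :=
    Summable.of_nonneg_of_le (fun X => by split_ifs <;> first | exact le_rfl | exact hvol0 X)
      (fun X => by split_ifs <;> first | exact hvol0 X | exact le_rfl) (h.summable_volume Λ)
  have hterm : ∀ X : Finset (ZdEdge d),
      |(if (X ∩ Λ).Nonempty then W X U else 0) - (if (X ∩ Λ).Nonempty then W X V else 0)| ≤
        2 * (if X ∈ S then 0 else ∑ e ∈ Λ, (if e ∈ X then B X else 0)) := by
    intro X
    by_cases hXS : X ∈ S
    · rw [if_pos hXS, mul_zero]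
      have hWX : W X U = W X V := hWdep X fun z hz => hUV z (hΛ' X hXS z (Finset.mem_coe.1 hz))
      split_ifs <;> simp [hWX]
    · rw [if_neg hXS]
      calc |(if (X ∩ Λ).Nonempty then W X U else 0) - (if (X ∩ Λ).Nonempty then W X V else 0)|
          ≤ |(if (X ∩ Λ).Nonempty then W X U else 0)| + |(if (X ∩ Λ).Nonempty then W X V else 0)| :=
            abs_sub _ _
        _ ≤ (∑ e ∈ Λ, (if e ∈ X then B X else 0)) + ∑ e ∈ Λ, (if e ∈ X then B X else 0) :=
            add_le_add (h.abs_term_le Λ X U) (h.abs_term_le Λ X V)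
        _ = 2 * ∑ e ∈ Λ, (if e ∈ X then B X else 0) := by ring
  rw [← hs1.tsum_sub hs2]
  calc |∑' X, ((if (X ∩ Λ).Nonempty then W X U else 0) - (if (X ∩ Λ).Nonempty then W X V else 0))|
      ≤ ∑' X, |(if (X ∩ Λ).Nonempty then W X U else 0) - (if (X ∩ Λ).Nonempty then W X V else 0)| := by
        have := norm_tsum_le_tsum_norm ((hs1.sub hs2).norm)
        simpa only [Real.norm_eq_abs] using this
    _ ≤ ∑' X, 2 * (if X ∈ S then 0 else ∑ e ∈ Λ, (if e ∈ X then B X else 0)) :=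
        (hs1.sub hs2).abs.tsum_le_tsum hterm (htail.mul_left 2)
    _ = 2 * ∑' X, (if X ∈ S then 0 else ∑ e ∈ Λ, (if e ∈ X then B X else 0)) := tsum_mul_left

end Series

/-! ### The tier-2 kernel average as a tilted product-Haar integral -/

section Kernel

variable {G : Type*} [Group G] [TopologicalSpace G] [IsTopologicalGroup G] [CompactSpace G]
  [MeasurableSpace G] [BorelSpace G] [SecondCountableTopology G] (ρ : G →* Matrix (Fin N) (Fin N) ℂ)
  {W : Potential (ZdEdge d) G} {B : Finset (ZdEdge d) → ℝ}

/-- **The tier-2 kernel average as a tilted product-Haar integral**: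
`γ^W_Λ F (η) = ∫ F(ζ ∨ η) μ_η(dζ)` with `μ_η = Haar^{⊗Λ}.tilted (ζ ↦ -β S_Λ(ζ ∨ η) - ∑'_{X ∩ Λ ≠ ∅} W_X(ζ ∨ η))`
(change of variables `map_tilted_comp`; tier-2 twin of `specAvg_perturbedYM_eq_tilted`). -/
theorem specAvg_perturbedYMS_eq_tilted (hρ : Continuous ρ) (β : ℝ) (h : IsLinkSummable W B)
    (hWc : ∀ X, Continuous (W X)) (Λ : Finset (ZdEdge d)) {F : LGConfig d G → ℝ} (hFm : Measurable F)
    (η : LGConfig d G) :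
    specAvg (perturbedYMS ρ β W) Λ F η =
      ∫ ζ, F (glueWith Λ ζ η) ∂((Measure.pi fun _ : ↥Λ => haarProbability G).tilted
        fun ζ => perturbedEnergyS ρ β W Λ (glueWith Λ ζ η)) := by
  unfold specAvg perturbedYMS
  rw [← map_tilted_comp _ (measurable_glueWith Λ η) (continuous_perturbedEnergyS ρ hρ β h hWc Λ).measurable,
    integral_map (measurable_glueWith Λ η).aemeasurable hFm.aestronglyMeasurable]
  rfl

end Kernel

/-! ### `SU(N)`: the energy is Lipschitz in every link; quasilocality and sitewise Lipschitz bounds of the smoothing -/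

section SUN

variable {W : Potential (ZdEdge d) (Matrix.specialUnitaryGroup (Fin N) ℂ)} {B : Finset (ZdEdge d) → ℝ}

/-- **The tier-2 energy is Lipschitz in every link** (`SU(N)`, fundamental representation, tree coupling
`b`): if `U = V` off `y` then
`|φ_Λ(U) − φ_Λ(V)| ≤ (|b| · 2(d−1)√N · 𝟙[y ∈ ⋃_{p ∩ Λ ≠ ∅} links(p)] + ∑_{e ∈ Λ} ∑'_{X ∋ e, y} lip X y) · ‖U_y − V_y‖_F`
— the Wilson part reads only the links of the plaquettes touching `Λ` (`isCylinder_wilsonBoundaryAction_holds`)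
and is `2(d−1)√N`-Lipschitz there (`ZdSmoothing.abs_wilsonBoundaryAction_sub_le_of_eq_off`); the series part
is `abs_tsum_volume_sub_le_of_eq_off`. -/
theorem abs_perturbedEnergyS_sub_le_of_eq_off (b : ℝ) (h : IsLinkSummable W B)
    (hWdep : ∀ X, DependsOn (W X) (↑X : Set (ZdEdge d)))
    {lip : Finset (ZdEdge d) → ZdEdge d → ℝ} (hlip : ∀ X, IsLipBound suFrobDist (W X) (lip X))
    (Λ : Finset (ZdEdge d)) {y : ZdEdge d}
    (hlips : ∀ e ∈ Λ, Summable fun X : Finset (ZdEdge d) => (if e ∈ X ∧ y ∈ X then lip X y else 0))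
    {U V : LGConfig d (Matrix.specialUnitaryGroup (Fin N) ℂ)} (hUV : ∀ z, z ≠ y → U z = V z) :
    |perturbedEnergyS (fundamentalRep (Fin N)) b W Λ U - perturbedEnergyS (fundamentalRep (Fin N)) b W Λ V| ≤
      (|b| * (((2 * (d - 1) : ℕ) : ℝ) * Real.sqrt N) *
          (if y ∈ (plaquettesTouching Λ).biUnion plaquetteEdges then 1 else 0) +
        ∑ e ∈ Λ, ∑' X : Finset (ZdEdge d), (if e ∈ X ∧ y ∈ X then lip X y else 0)) *
        suFrobDist (U y) (V y) := by
  classical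
  have hr0 : 0 ≤ suFrobDist (U y) (V y) := suFrobDist_nonneg _ _
  -- Wilson part
  have hS : |wilsonBoundaryAction (fundamentalRep (Fin N)) Λ U - wilsonBoundaryAction (fundamentalRep (Fin N)) Λ V| ≤
      ((2 * (d - 1) : ℕ) : ℝ) * Real.sqrt N *
        (if y ∈ (plaquettesTouching Λ).biUnion plaquetteEdges then 1 else 0) * suFrobDist (U y) (V y) := by
    split_ifs with hy
    · rw [mul_one, mul_assoc]
      exact abs_wilsonBoundaryAction_sub_le_of_eq_off (N := N) Λ hUV
    · have heq : wilsonBoundaryAction (fundamentalRep (Fin N)) Λ U =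
          wilsonBoundaryAction (fundamentalRep (Fin N)) Λ V :=
        isCylinder_wilsonBoundaryAction_holds (fundamentalRep (Fin N)) Λ fun z hz =>
          hUV z fun hzy => hy (hzy ▸ hz)
      rw [heq, sub_self, abs_zero, mul_zero, zero_mul]
  -- series part
  have hT := abs_tsum_volume_sub_le_of_eq_off h hWdep (fun _ _ => suFrobDist_nonneg _ _) hlip Λ hlips hUV
  have e : perturbedEnergyS (fundamentalRep (Fin N)) b W Λ U - perturbedEnergyS (fundamentalRep (Fin N)) b W Λ V =
      -(b * (wilsonBoundaryAction (fundamentalRep (Fin N)) Λ U - wilsonBoundaryAction (fundamentalRep (Fin N)) Λ V) +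
        ((∑' X : Finset (ZdEdge d), (if (X ∩ Λ).Nonempty then W X U else 0)) -
          ∑' X : Finset (ZdEdge d), (if (X ∩ Λ).Nonempty then W X V else 0))) := by
    unfold perturbedEnergyS; ring
  rw [e, abs_neg]
  refine (abs_add_le _ _).trans ?_
  rw [abs_mul, add_mul]
  refine add_le_add ?_ hT
  calc |b| * |wilsonBoundaryAction (fundamentalRep (Fin N)) Λ U - wilsonBoundaryAction (fundamentalRep (Fin N)) Λ V|
      ≤ |b| * (((2 * (d - 1) : ℕ) : ℝ) * Real.sqrt N *
          (if y ∈ (plaquettesTouching Λ).biUnion plaquetteEdges then 1 else 0) * suFrobDist (U y) (V y)) :=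
        mul_le_mul_of_nonneg_left hS (abs_nonneg b)
    _ = |b| * (((2 * (d - 1) : ℕ) : ℝ) * Real.sqrt N) *
          (if y ∈ (plaquettesTouching Λ).biUnion plaquetteEdges then 1 else 0) * suFrobDist (U y) (V y) := by
        ring

end SUN

end Summit.Ventures.YMGap.RobustBall

end
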